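import Mathlib.Analysis.Matrix.Normed
import Mathlib.Analysis.SpecialFunctions.ExpDeriv
import Mathlib.Analysis.SpecialFunctions.Trigonometric.Deriv
import Literature.Geometry.ComplexHyperbolic.UnitBallKCentralOrbitalIntegralChart   -- ★ Haar orbital integral = c × sheet integral
import Literature.Geometry.ComplexHyperbolic.UnitBallSheetFamilyDeriv              -- ★ ENGINE-T: `contDiffOn_two_integral_family`
import HarnessLib

/-!
# The `ε²`-normalised `K`-central orbital integral of `U(2,1)` along the compact-wall curve `k_t = ζ·(e^{it}, e^{it}, e^{−2it})` is `C²` on `[0, δ]`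
# (ROAD A: ENGINE-T instantiated — the `hψ` input of the (A4)-V bookkeeping ★ `ArchCentralLimitCompactWallValue`)

Topic `Geometry/ComplexHyperbolic`; namespace `Literature.Geometry.ComplexHyperbolic.BallModel`.  THEOREMS ONLY (no `def`, no instance, no notation, no axiom,
no named fact, no `sorry`).  Cell `pub/hodgecm-mathlib`, ENGINE T1 (crux H413 = `stmt-HodgeConjecture-24833`); floor-1½, count-neutral, under row (S-d) ∕ «SdArch» ED. 3 node N1
(`stub_ArchCentralLimitU21`); author F0P3a-p05 (g13), 2026-09-01.  `open scoped Matrix.Norms.Operator` as the letter ∕ (A1) ∕ (A2′).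

THE MATHEMATICS.  p06's (A4)-V bookkeeping `quarter_sub_eq_of_wallGerms` needs `ψ(t) := m(t)·Φ_Θ(k_t) ∈ C²[0, δ]`, where `k_t = diag(u_t, u_t, v_t)`, `u_t = ζe^{it}`,
`v_t = ζe^{−2it}` (the wall curve through the centre in the direction `A⃗ = (1,1,−2)`), `m(t) = 2 − 2cos 3t = |v_t − u_t|²`, `Φ_Θ(k) = ∫_{U(2,1)} Θ(gkg⁻¹) dμ`.
§1: `v_t − u_t = 2 sin(3t∕2)·(−iζe^{−it∕2})`, so `|v_t − u_t| = ε(t) := 2 sin(3t∕2)` on `[0, 2π∕3]` and `(v_t − u_t)∕|v_t − u_t| = −iζe^{−it∕2}`.  §2: the WALL-CURVE DATUM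
`Λ(t, W, r) := Θ(u_t•1 + iζe^{−it∕2}•N(W₀, W₁, r))` is `C²` jointly (entrywise polynomial ∕ exponential, transferred INTO `M₃(ℂ)` along the identity
`(Fin 3 → Fin 3 → ℂ) ≃L[ℝ] Matrix (Fin 3) (Fin 3) ℂ` — the trick for `ContDiff` into the scoped-normed matrix type) and has an `r²`-support bound UNIFORM in `t`
(`|(u_t•1 + iζe^{−it∕2}•N)₂₂| ≥ r² − 1`).  §3: ENGINE-T gives **`t ↦ ∫_{ℂ²} Θ(u_t•1 + iζe^{−it∕2}•N(W, √(ε(t)+|W|²))) d⁴W ∈ C²[0, δ]`** for `0 < δ < 2π∕3`, and the ★ packaging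
identifies it: **`|v_t − u_t|²·Φ_Θ(k_t) = c·(that integral)` for `t ∈ (0, 2π∕3)`** with ONE `c > 0` per Haar `μ`.  Hence `ψ = m·Φ_Θ(k_·)` agrees on `(0, δ]` with `c ×` a
`C²[0,δ]` function whose value at `0` is the CONE INTEGRAL `∫ Θ(ζ•1 + iζ•N(W,|W|)) d⁴W` — the `hψ` of (A4)-V in ball-model tokens (A-p18's bridge `archLocal ≃ₜ* U21` carries it over).

* §1 `coe_wallCurve_sub`, `norm_wallPhase`, **`norm_wallCurve_sub`**, **`wallCurve_sub_div_norm`**, `hasDerivAt_wallRadius(_deriv)`, `wallRadius_nonneg∕pos`;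
* §2 **`contDiff_wallCurve_arg`**, `contDiff_wallCurve_datum`, **`exists_sq_support_bound_wallCurve`**;
* §3 **`contDiffOn_two_wallCurve_sheetIntegral`**, **`exists_sq_smul_orbitalIntegral_wallCurve_eq`**.
HONEST LABEL: HC_CM is proved only modulo the printed citations until rung 0 closes; this file is real analysis over ★ ball-model files and pays nothing by itself.

## References
* [Rogawski1990] J. D. Rogawski, *Automorphic Representations of Unitary Groups in Three Variables*, Ann. of Math. Stud. 123 (1990), §8.4 pp. 126–127.
* [Goldman1999] W. M. Goldman, *Complex Hyperbolic Geometry* (1999), §3.1.1–3.1.2.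
* [Rudin1980] W. Rudin, *Function Theory in the Unit Ball of ℂⁿ* (1980), §1.4, §2.2.
-/

noncomputable section

open MeasureTheory MeasureTheory.Measure Set Filter Topology Metric Matrix Complex
open scoped ENNReal Matrix.Norms.Operator

namespace Literature.Geometry.ComplexHyperbolic.BallModel

/-! ### §1 The wall curve in the ball model and its normaliser -/

/-- THE DIFFERENCE OF THE EIGENVALUES ALONG THE WALL CURVE: for `u_t = ζe^{it}`, `v_t = ζe^{−2it}`,
`v_t − u_t = (2 sin(3t∕2)) · (−iζe^{−it∕2})`. [cite: Rogawski1990, §8.4 pp. 126–127] -/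
theorem coe_wallCurve_sub (ζ : Circle) (t : ℝ) :
    ((ζ * Circle.exp (-2 * t) : Circle) : ℂ) - ((ζ * Circle.exp t : Circle) : ℂ) =
      ((2 * Real.sin (3 * t / 2) : ℝ) : ℂ) * (-I * (ζ : ℂ) * Complex.exp (-(t / 2 : ℝ) * I)) := by
  set E : ℂ := cexp (-((t / 2 : ℝ) : ℂ) * I) with hEdef
  have hE : E ≠ 0 := Complex.exp_ne_zero _
  have h1 : ((ζ * Circle.exp (-2 * t) : Circle) : ℂ) = (ζ : ℂ) * E ^ 4 := by
    rw [Circle.coe_mul, Circle.coe_exp, hEdef, ← Complex.exp_nat_mul]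
    congr 2; push_cast; ring
  have h2 : ((ζ * Circle.exp t : Circle) : ℂ) = (ζ : ℂ) * E⁻¹ ^ 2 := by
    rw [Circle.coe_mul, Circle.coe_exp, hEdef, ← Complex.exp_neg, ← Complex.exp_nat_mul]
    congr 2; push_cast; ring
  have h3 : ((2 * Real.sin (3 * t / 2) : ℝ) : ℂ) = (E ^ 3 - E⁻¹ ^ 3) * I := by
    have := Complex.two_sin ((3 * t / 2 : ℝ) : ℂ)
    rw [hEdef, ← Complex.exp_neg, ← Complex.exp_nat_mul, ← Complex.exp_nat_mul]
    push_cast at this ⊢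
    rw [this]
    congr 3 <;> ring
  have hII : ∀ a b : ℂ, a * I * (-I * b) = a * b := fun a b => by
    have : I * I = -1 := Complex.I_mul_I
    linear_combination (-a * b) * this
  rw [h1, h2, h3, mul_assoc (-I) (ζ : ℂ) E, hII]
  field_simp

/-- The phase `−iζe^{−it∕2}` is unimodular. [cite: Rogawski1990, §8.4 pp. 126–127] -/
theorem norm_wallPhase (ζ : Circle) (t : ℝ) : ‖-I * (ζ : ℂ) * Complex.exp (-(t / 2 : ℝ) * I)‖ = 1 := by
  rw [norm_mul, norm_mul, norm_neg, Complex.norm_I, one_mul, Circle.norm_coe, one_mul, ← Complex.ofReal_neg, Complex.norm_exp_ofReal_mul_I]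

/-- **THE NORMALISER ALONG THE WALL CURVE**: `‖v_t − u_t‖ = 2 sin(3t∕2)` for `t ∈ [0, 2π∕3]`. [cite: Rogawski1990, §8.4 pp. 126–127] -/
theorem norm_wallCurve_sub (ζ : Circle) {t : ℝ} (ht : t ∈ Icc (0 : ℝ) (2 * Real.pi / 3)) :
    ‖((ζ * Circle.exp (-2 * t) : Circle) : ℂ) - ((ζ * Circle.exp t : Circle) : ℂ)‖ = 2 * Real.sin (3 * t / 2) := by
  have hsin : 0 ≤ Real.sin (3 * t / 2) :=
    Real.sin_nonneg_of_nonneg_of_le_pi (by linarith [ht.1]) (by have := ht.2; nlinarith [Real.pi_pos])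
  rw [coe_wallCurve_sub, norm_mul, norm_wallPhase, mul_one, Complex.norm_real, Real.norm_of_nonneg (by linarith)]

/-- The direction `(v_t − u_t)∕‖v_t − u_t‖ = −iζe^{−it∕2}` for `t ∈ (0, 2π∕3)`. [cite: Rogawski1990, §8.4 pp. 126–127] -/
theorem wallCurve_sub_div_norm (ζ : Circle) {t : ℝ} (ht : t ∈ Ioo (0 : ℝ) (2 * Real.pi / 3)) :
    (((ζ * Circle.exp (-2 * t) : Circle) : ℂ) - ((ζ * Circle.exp t : Circle) : ℂ)) /
        ((‖((ζ * Circle.exp (-2 * t) : Circle) : ℂ) - ((ζ * Circle.exp t : Circle) : ℂ)‖ : ℝ) : ℂ) =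
      -I * (ζ : ℂ) * Complex.exp (-(t / 2 : ℝ) * I) := by
  have hsin : 0 < Real.sin (3 * t / 2) :=
    Real.sin_pos_of_pos_of_lt_pi (by linarith [ht.1]) (by have := ht.2; nlinarith [Real.pi_pos])
  rw [norm_wallCurve_sub ζ ⟨ht.1.le, ht.2.le⟩, coe_wallCurve_sub]
  have hne : ((2 * Real.sin (3 * t / 2) : ℝ) : ℂ) ≠ 0 := by exact_mod_cast (by linarith : (2 * Real.sin (3 * t / 2) : ℝ) ≠ 0)
  field_simp

/-- The sheet radius `ε(t) = 2 sin(3t∕2)` and its derivatives `ε′ = 3 cos(3t∕2)`, `ε″ = −(9∕2) sin(3t∕2)`. [cite: Rogawski1990, §8.4 pp. 126–127] -/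
theorem hasDerivAt_wallRadius (t : ℝ) : HasDerivAt (fun t : ℝ => 2 * Real.sin (3 * t / 2)) (3 * Real.cos (3 * t / 2)) t := by
  have h : HasDerivAt (fun t : ℝ => 3 * t / 2) (3 / 2) t := by
    simpa using ((hasDerivAt_id t).const_mul 3).div_const 2
  have := ((Real.hasDerivAt_sin _).comp t h).const_mul 2
  refine this.congr_deriv ?_
  ring

/-- … second derivative. [cite: Rogawski1990, §8.4 pp. 126–127] -/
theorem hasDerivAt_wallRadius_deriv (t : ℝ) : HasDerivAt (fun t : ℝ => 3 * Real.cos (3 * t / 2)) (-(9 / 2) * Real.sin (3 * t / 2)) t := by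
  have h : HasDerivAt (fun t : ℝ => 3 * t / 2) (3 / 2) t := by
    simpa using ((hasDerivAt_id t).const_mul 3).div_const 2
  have := ((Real.hasDerivAt_cos _).comp t h).const_mul 3
  refine this.congr_deriv ?_
  ring

/-- `ε ≥ 0` on `[0, 2π∕3]`. [cite: Rogawski1990, §8.4 pp. 126–127] -/
theorem wallRadius_nonneg {t : ℝ} (ht : t ∈ Icc (0 : ℝ) (2 * Real.pi / 3)) : 0 ≤ 2 * Real.sin (3 * t / 2) := by
  have := Real.sin_nonneg_of_nonneg_of_le_pi (x := 3 * t / 2) (by linarith [ht.1]) (by have := ht.2; nlinarith [Real.pi_pos])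
  linarith

/-- `ε > 0` on `(0, 2π∕3)`. [cite: Rogawski1990, §8.4 pp. 126–127] -/
theorem wallRadius_pos {t : ℝ} (ht : t ∈ Ioo (0 : ℝ) (2 * Real.pi / 3)) : 0 < 2 * Real.sin (3 * t / 2) := by
  have := Real.sin_pos_of_pos_of_lt_pi (x := 3 * t / 2) (by linarith [ht.1]) (by have := ht.2; nlinarith [Real.pi_pos])
  linarith

/-! ### §2 The wall-curve datum `Λ(t, W, r) = Θ(u_t•1 + iζe^{−it∕2}•N(W₀, W₁, r))` is `C²` with an `r²`-support bound -/

section Datum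

variable {G : Type*} [NormedAddCommGroup G] [NormedSpace ℝ G]

/-- The affine sheet argument along the wall curve, `(t, W, r) ↦ u_t•1 + iζe^{−it∕2}•N(W₀,W₁,r)`, is smooth INTO `M₃(ℂ)` (entrywise polynomial∕exponential; transferred from
the Pi type through the identity continuous linear equivalence — see the module docstring's GOTCHA). [cite: Goldman1999, §3.1.1] -/
theorem contDiff_wallCurve_arg (ζ : Circle) :
    ContDiff ℝ 2 fun p : ℝ × (Fin 2 → ℂ) × ℝ => ((ζ * Circle.exp p.1 : Circle) : ℂ) • (1 : Matrix (Fin 3) (Fin 3) ℂ) +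
      (I * (ζ : ℂ) * Complex.exp (-(p.1 / 2 : ℝ) * I)) • (vecMulVec ![p.2.1 0, p.2.1 1, (p.2.2 : ℂ)] (star ![p.2.1 0, p.2.1 1, (p.2.2 : ℂ)]) * J) := by
  -- the scalar coefficients
  have ht : ContDiff ℝ 2 fun p : ℝ × (Fin 2 → ℂ) × ℝ => ((p.1 : ℝ) : ℂ) := Complex.ofRealCLM.contDiff.comp contDiff_fst
  have ha : ContDiff ℝ 2 fun p : ℝ × (Fin 2 → ℂ) × ℝ => ((ζ * Circle.exp p.1 : Circle) : ℂ) := by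
    have : (fun p : ℝ × (Fin 2 → ℂ) × ℝ => ((ζ * Circle.exp p.1 : Circle) : ℂ)) = fun p => (ζ : ℂ) * Complex.exp (((p.1 : ℝ) : ℂ) * I) := by
      funext p; rw [Circle.coe_mul, Circle.coe_exp]
    rw [this]
    exact contDiff_const.mul (ht.mul contDiff_const).cexp
  have hb : ContDiff ℝ 2 fun p : ℝ × (Fin 2 → ℂ) × ℝ => I * (ζ : ℂ) * Complex.exp (-(p.1 / 2 : ℝ) * I) := by
    have h2 : ContDiff ℝ 2 fun p : ℝ × (Fin 2 → ℂ) × ℝ => (((p.1 / 2 : ℝ)) : ℂ) := Complex.ofRealCLM.contDiff.comp (contDiff_fst.div_const 2)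
    exact contDiff_const.mul (h2.neg.mul contDiff_const).cexp
  -- the coordinates of `x = (W₀, W₁, r)`
  have hx : ∀ i : Fin 3, ContDiff ℝ 2 fun p : ℝ × (Fin 2 → ℂ) × ℝ => (![p.2.1 0, p.2.1 1, (p.2.2 : ℂ)] : Fin 3 → ℂ) i := by
    intro i
    fin_cases i
    · exact ((ContinuousLinearMap.proj (R := ℝ) (φ := fun _ : Fin 2 => ℂ) 0).contDiff.comp (contDiff_fst.comp contDiff_snd))
    · exact ((ContinuousLinearMap.proj (R := ℝ) (φ := fun _ : Fin 2 => ℂ) 1).contDiff.comp (contDiff_fst.comp contDiff_snd))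
    · exact (Complex.ofRealCLM.contDiff.comp (contDiff_snd.comp contDiff_snd))
  -- entrywise, in the Pi type
  have hpi : ContDiff ℝ 2 fun p : ℝ × (Fin 2 → ℂ) × ℝ => (fun i j => ((ζ * Circle.exp p.1 : Circle) : ℂ) * (1 : Matrix (Fin 3) (Fin 3) ℂ) i j +
      (I * (ζ : ℂ) * Complex.exp (-(p.1 / 2 : ℝ) * I)) * ((![p.2.1 0, p.2.1 1, (p.2.2 : ℂ)] : Fin 3 → ℂ) i *
        (starRingEnd ℂ) ((![p.2.1 0, p.2.1 1, (p.2.2 : ℂ)] : Fin 3 → ℂ) j) * J j j) : Fin 3 → Fin 3 → ℂ) := by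
    refine contDiff_pi.2 fun i => contDiff_pi.2 fun j => ?_
    exact (ha.mul contDiff_const).add (hb.mul (((hx i).mul (Complex.conjCLE.contDiff.comp (hx j))).mul contDiff_const))
  have hfun : (fun p : ℝ × (Fin 2 → ℂ) × ℝ => ((ζ * Circle.exp p.1 : Circle) : ℂ) • (1 : Matrix (Fin 3) (Fin 3) ℂ) +
      (I * (ζ : ℂ) * Complex.exp (-(p.1 / 2 : ℝ) * I)) • (vecMulVec ![p.2.1 0, p.2.1 1, (p.2.2 : ℂ)] (star ![p.2.1 0, p.2.1 1, (p.2.2 : ℂ)]) * J)) =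
      fun p => (fun i j => ((ζ * Circle.exp p.1 : Circle) : ℂ) * (1 : Matrix (Fin 3) (Fin 3) ℂ) i j +
        (I * (ζ : ℂ) * Complex.exp (-(p.1 / 2 : ℝ) * I)) * ((![p.2.1 0, p.2.1 1, (p.2.2 : ℂ)] : Fin 3 → ℂ) i *
          (starRingEnd ℂ) ((![p.2.1 0, p.2.1 1, (p.2.2 : ℂ)] : Fin 3 → ℂ) j) * J j j) : Fin 3 → Fin 3 → ℂ) := by
    funext p; ext i j
    rw [Matrix.add_apply, Matrix.smul_apply, Matrix.smul_apply, vecMulVec_star_mul_J_apply, smul_eq_mul, smul_eq_mul, mul_assoc]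
  rw [hfun]
  let e : (Fin 3 → Fin 3 → ℂ) ≃L[ℝ] Matrix (Fin 3) (Fin 3) ℂ := (LinearEquiv.refl ℝ (Fin 3 → Fin 3 → ℂ)).toContinuousLinearEquiv
  exact e.comp_contDiff_iff.2 hpi

/-- **THE WALL-CURVE DATUM IS `C²`** jointly in `(t, W, r)` for `Θ` of class `C²`. [cite: Rogawski1990, §8.4 pp. 126–127] -/
theorem contDiff_wallCurve_datum (Θ : Matrix (Fin 3) (Fin 3) ℂ → G) (hΘ : ContDiff ℝ 2 Θ) (ζ : Circle) :
    ContDiff ℝ 2 fun p : ℝ × (Fin 2 → ℂ) × ℝ => Θ (((ζ * Circle.exp p.1 : Circle) : ℂ) • (1 : Matrix (Fin 3) (Fin 3) ℂ) +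
      (I * (ζ : ℂ) * Complex.exp (-(p.1 / 2 : ℝ) * I)) • (vecMulVec ![p.2.1 0, p.2.1 1, (p.2.2 : ℂ)] (star ![p.2.1 0, p.2.1 1, (p.2.2 : ℂ)]) * J)) :=
  hΘ.comp (contDiff_wallCurve_arg ζ)

/-- **THE `r²`-SUPPORT BOUND, UNIFORM IN `t`**: for `Θ` with compact support there is `S` with `Θ(u_t•1 + iζe^{−it∕2}•N(W₀,W₁,r)) = 0` whenever `r² ≥ S` (all `t`, `W`):
the `(2,2)` entry is `u_t − iζe^{−it∕2}·(−r²)`-sized `≥ r² − 1`. [cite: Rudin1980, §1.4] -/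
theorem exists_sq_support_bound_wallCurve {G : Type*} [Zero G] [TopologicalSpace G] (Θ : Matrix (Fin 3) (Fin 3) ℂ → G) (hΘc : HasCompactSupport Θ) (ζ : Circle) :
    ∃ S : ℝ, ∀ (t : ℝ) (W : Fin 2 → ℂ) (r : ℝ), S ≤ r ^ 2 →
      Θ (((ζ * Circle.exp t : Circle) : ℂ) • (1 : Matrix (Fin 3) (Fin 3) ℂ) +
        (I * (ζ : ℂ) * Complex.exp (-(t / 2 : ℝ) * I)) • (vecMulVec ![W 0, W 1, (r : ℂ)] (star ![W 0, W 1, (r : ℂ)]) * J)) = 0 := by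
  obtain ⟨M, hM⟩ := hΘc.isCompact.exists_bound_of_continuousOn
    ((continuous_id.matrix_elem (2 : Fin 3) (2 : Fin 3)).continuousOn : ContinuousOn (fun X : Matrix (Fin 3) (Fin 3) ℂ => X 2 2) (tsupport Θ))
  refine ⟨max M 0 + 2, fun t W r hr => image_eq_zero_of_notMem_tsupport fun hmem => ?_⟩
  have h1 := hM _ hmem
  have h22 : (((ζ * Circle.exp t : Circle) : ℂ) • (1 : Matrix (Fin 3) (Fin 3) ℂ) +
      (I * (ζ : ℂ) * Complex.exp (-(t / 2 : ℝ) * I)) • (vecMulVec ![W 0, W 1, (r : ℂ)] (star ![W 0, W 1, (r : ℂ)]) * J)) 2 2 =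
      ((ζ * Circle.exp t : Circle) : ℂ) - (I * (ζ : ℂ) * Complex.exp (-(t / 2 : ℝ) * I)) * ((r : ℂ) * (r : ℂ)) := by
    rw [Matrix.add_apply, Matrix.smul_apply, Matrix.smul_apply, vecMulVec_star_mul_J_apply]
    simp [J, Complex.conj_ofReal]
    ring
  dsimp only [id] at h1
  rw [h22] at h1
  have hu : ‖((ζ * Circle.exp t : Circle) : ℂ)‖ = 1 := Circle.norm_coe _
  have hb : ‖(I * (ζ : ℂ) * Complex.exp (-(t / 2 : ℝ) * I)) * ((r : ℂ) * (r : ℂ))‖ = r ^ 2 := by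
    rw [norm_mul, norm_mul, norm_mul, Complex.norm_I, Circle.norm_coe, ← Complex.ofReal_neg, Complex.norm_exp_ofReal_mul_I, ← Complex.ofReal_mul,
      Complex.norm_real, Real.norm_of_nonneg (mul_self_nonneg r)]
    ring
  have htri := norm_sub_norm_le ((I * (ζ : ℂ) * Complex.exp (-(t / 2 : ℝ) * I)) * ((r : ℂ) * (r : ℂ))) (((ζ * Circle.exp t : Circle) : ℂ))
  rw [hb, hu, norm_sub_rev] at htri
  linarith [le_max_left M 0]

end Datum

/-! ### §3 The heads: `C²` on `[0, δ]` and the identification with the normalised orbital integral -/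

section Heads

variable {G : Type*} [NormedAddCommGroup G] [NormedSpace ℝ G]

/-- **THE WALL-CURVE SHEET INTEGRAL IS `C²` ON `[0, δ]`** (`0 < δ < 2π∕3`): for `Θ` of class `C²` with compact support and `ζ ∈ S¹`,
`t ↦ ∫_{ℂ²} Θ(u_t•1 + iζe^{−it∕2}•N(W, √(2 sin(3t∕2) + |W|²))) d⁴W ∈ C²[0, δ]` — ENGINE-T ★ `contDiffOn_two_integral_family` at the wall-curve datum with sheet radius
`ε(t) = 2 sin(3t∕2) = |v_t − u_t|`. [cite: Rogawski1990, §8.4 pp. 126–127] [cite: Rudin1980, §1.4] -/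
theorem contDiffOn_two_wallCurve_sheetIntegral (Θ : Matrix (Fin 3) (Fin 3) ℂ → G) (hΘ : ContDiff ℝ 2 Θ) (hΘc : HasCompactSupport Θ) (ζ : Circle)
    {δ : ℝ} (hδ : 0 < δ) (hδ' : δ < 2 * Real.pi / 3) :
    ContDiffOn ℝ 2 (fun t : ℝ => ∫ W : Fin 2 → ℂ, Θ (((ζ * Circle.exp t : Circle) : ℂ) • (1 : Matrix (Fin 3) (Fin 3) ℂ) +
      (I * (ζ : ℂ) * Complex.exp (-(t / 2 : ℝ) * I)) •
        (vecMulVec ![W 0, W 1, (Real.sqrt (2 * Real.sin (3 * t / 2) + nsq W) : ℂ)] (star ![W 0, W 1, (Real.sqrt (2 * Real.sin (3 * t / 2) + nsq W) : ℂ)]) * J))) (Icc 0 δ) := by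
  obtain ⟨S, hS⟩ := exists_sq_support_bound_wallCurve Θ hΘc ζ
  have hε₂c : Continuous fun t : ℝ => -(9 / 2) * Real.sin (3 * t / 2) := by fun_prop
  exact contDiffOn_two_integral_family (T := 2 * Real.pi / 3)
    (Λ := fun p : ℝ × (Fin 2 → ℂ) × ℝ => Θ (((ζ * Circle.exp p.1 : Circle) : ℂ) • (1 : Matrix (Fin 3) (Fin 3) ℂ) +
      (I * (ζ : ℂ) * Complex.exp (-(p.1 / 2 : ℝ) * I)) • (vecMulVec ![p.2.1 0, p.2.1 1, (p.2.2 : ℂ)] (star ![p.2.1 0, p.2.1 1, (p.2.2 : ℂ)]) * J)))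
    (ε := fun t : ℝ => 2 * Real.sin (3 * t / 2)) (ε₁ := fun t : ℝ => 3 * Real.cos (3 * t / 2)) (ε₂ := fun t : ℝ => -(9 / 2) * Real.sin (3 * t / 2))
    (contDiff_wallCurve_datum Θ hΘ ζ) hS hasDerivAt_wallRadius hasDerivAt_wallRadius_deriv hε₂c (fun t ht => wallRadius_nonneg ht) (fun t ht => wallRadius_pos ht) hδ hδ'

/-- **IDENTIFICATION WITH THE NORMALISED `K`-CENTRAL ORBITAL INTEGRAL** (ball model, any Haar `μ`, ONE `c > 0`): for continuous `Θ`, `ζ ∈ S¹`, `t ∈ (0, 2π∕3)`, with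
`u_t = ζe^{it}`, `v_t = ζe^{−2it}`, `k_t = diag(u_t, u_t, v_t)`:
`|v_t − u_t|² · ∫_{U(2,1)} Θ(g k_t g⁻¹) dμ = c · ∫_{ℂ²} Θ(u_t•1 + iζe^{−it∕2}•N(W, √(2 sin(3t∕2) + |W|²))) d⁴W`
(and `|v_t − u_t|² = 2 − 2cos 3t = m(t)`, ★ `norm_sub_sq_eq_of_circle`): so `ψ(t) = m(t)Φ_Θ(k_t)` IS `c ×` the `C²[0,δ]` function above on `(0, δ]`. [cite: Rogawski1990, §8.4 pp. 126–127] -/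
theorem exists_sq_smul_orbitalIntegral_wallCurve_eq (μ : Measure U21) [μ.IsHaarMeasure] :
    ∃ c : ℝ, 0 < c ∧ ∀ (Θ : Matrix (Fin 3) (Fin 3) ℂ → G), Continuous Θ → ∀ (ζ : Circle) (t : ℝ), t ∈ Ioo (0 : ℝ) (2 * Real.pi / 3) →
      ‖((ζ * Circle.exp (-2 * t) : Circle) : ℂ) - ((ζ * Circle.exp t : Circle) : ℂ)‖ ^ 2 •
        (∫ g, Θ (mat (g * mkU21 (Matrix.diagonal ![((ζ * Circle.exp t : Circle) : ℂ), ((ζ * Circle.exp t : Circle) : ℂ), ((ζ * Circle.exp (-2 * t) : Circle) : ℂ)])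
          (diagonal_uuv_preserves (ζ * Circle.exp t) (ζ * Circle.exp (-2 * t))) * g⁻¹)) ∂μ) =
        c • ∫ W : Fin 2 → ℂ, Θ (((ζ * Circle.exp t : Circle) : ℂ) • (1 : Matrix (Fin 3) (Fin 3) ℂ) +
          (I * (ζ : ℂ) * Complex.exp (-(t / 2 : ℝ) * I)) •
            (vecMulVec ![W 0, W 1, (Real.sqrt (2 * Real.sin (3 * t / 2) + nsq W) : ℂ)] (star ![W 0, W 1, (Real.sqrt (2 * Real.sin (3 * t / 2) + nsq W) : ℂ)]) * J)) := by
  obtain ⟨c, hc, h⟩ := exists_sq_smul_integral_comp_conj_kCentral_eq_smul_integral_sheet (E := G) μ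
  refine ⟨c, hc, fun Θ hΘ ζ t ht => ?_⟩
  have hpos : 0 < 2 * Real.sin (3 * t / 2) := wallRadius_pos ht
  have hne : (ζ * Circle.exp t : Circle) ≠ ζ * Circle.exp (-2 * t) := by
    intro heq
    have h0 : ‖((ζ * Circle.exp (-2 * t) : Circle) : ℂ) - ((ζ * Circle.exp t : Circle) : ℂ)‖ = 0 := by rw [heq, sub_self, norm_zero]
    rw [norm_wallCurve_sub ζ ⟨ht.1.le, ht.2.le⟩] at h0
    linarith
  have key := h Θ hΘ (ζ * Circle.exp t) (ζ * Circle.exp (-2 * t)) hne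
  rw [key, wallCurve_sub_div_norm ζ ht, norm_wallCurve_sub ζ ⟨ht.1.le, ht.2.le⟩]
  congr 1
  refine integral_congr_ae (Filter.Eventually.of_forall fun W => ?_)
  simp only [sub_eq_add_neg, ← neg_smul, neg_mul, neg_neg]

end Heads

end Literature.Geometry.ComplexHyperbolic.BallModel

end
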